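import Mathlib
import HarnessLib
import HarnessLib.Audit
import Summits.CriticalPhenomena.Statement
import Summits.CriticalPhenomena.CardyFormulaZ2.Theorems.CardyAnchoredRigidityAssembly
import HarnessLib.Audit.Status.Attr

/-!
Route: CardyLocalRigidity

DORMANT since 2026-08-25T14:51:34Z (reconciler: no traction for 7.8 d (last activity item-evidence-added at 2026-08-17T19:17:51Z); parked, not closed — `ledger route dormant route-CriticalPhenomena-CardyLocalRigidity --off` to reactivat) — unstaffed, not closed; items shared with open routes are served there. `ledger route dormant <id> --off` reactivates.

# Route CardyLocalRigidity — connected cluster set of Z2 crossing laws plus local rigidity at the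
Cardy point gives the limit

It suffices to show X [the cluster set is the Cardy point]: every cluster point g, as δ → 0⁺, of the
crossing-FUNCTION path
δ ↦ (R ↦ P_{1/2}[bond-ℤ² crossing of the conformal rectangle R at mesh δ]) in the compact product
space [0,1]^{ConformalRectangle}
is the Cardy shadow g_F (g_F(R) = F(η_R) for every uniformizing datum of R); by compactness this is
CardyFormulaZ2 with the limit's
existence made explicit. X is reached as X ⇐ X₁ ∧ X₂ ∧ X₃ (card
cle6-local-rigidity-connected-limits): X₁ = SubseqCardy (g_F IS a
cluster point: Cardy along one sequence of meshes, imported from the upgrade programme), X₂ =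
ClusterSetConnected (the cluster set Λ'
is connected: asymptotic continuity in log δ), X₃ = CardyShadowIsolated (g_F is an ISOLATED point of
Λ': local rigidity at CLE₆).
A connected set with an isolated member is that member, so Λ' = {g_F}: LimitExists, conformal
invariance and Cardy's value at once.
Lean: `∀ g : Literature.Probability.RandomPlanarGeometry.ConformalRectangle → ℝ, MapClusterPt g
(nhdsWithin (0 : ℝ) (Set.Ioi 0)) (fun (δ : ℝ) (R :
Literature.Probability.RandomPlanarGeometry.ConformalRectangle) =>
Literature.Probability.Percolation.bondDomainCrossingProb R δ) → ∀ (R :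
Literature.Probability.RandomPlanarGeometry.ConformalRectangle) (φ :
Literature.Probability.RandomPlanarGeometry.ConformalEquiv UpperHalfPlane.upperHalfPlaneSet
R.carrier) (x : Fin 4 → ℝ), R.IsUniformizing φ x → g R =
Literature.Probability.RandomPlanarGeometry.cardyFunction
(Literature.Probability.RandomPlanarGeometry.crossRatio x)`

## Assembly
Pure point-set topology, no named facts (core lemma checked sorry-free in the planner's
SketchTest.lean): (1) from SubseqCardy's sequence u,
the product path n ↦ P(u n) lives in the compact set Set.pi univ (fun _ ↦ Icc 0 1)
(bondDomainCrossingProb_mem_Icc, isCompact_univ_pi), so it has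
a cluster point g (IsCompact.exists_mapClusterPt / exists_clusterPt), which is a cluster point of P
along 𝓝[>]0 (ClusterPt.mono, map u atTop ≤ 𝓝[>]0)
and is a Cardy shadow (each coordinate with a uniformizing datum converges; cluster values of a
convergent real sequence equal its limit, T2);
(2) CardyShadowIsolated gives U ∈ 𝓝 g with U ∩ Λ' ⊆ {g}; with ClusterSetConnected, the open cover
{interior U, {g}ᶜ} of Λ' forces Λ' ⊆ {g}
(IsPreconnected applied to two open sets; T2 separation of the product of ℝ's); (3) P is eventually
(in fact always) in the compact product of
[0,1]'s and has the unique cluster point g there, so Tendsto P (𝓝[>]0) (𝓝 g)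
(IsCompact.tendsto_nhds_of_unique_mapClusterPt); (4) tendsto_pi_nhds
gives Tendsto (bondDomainCrossingProb R) (𝓝[>]0) (𝓝 (g R)) and g R = F(crossRatio x) for every
uniformizing datum: R.HasCrossingLimit, i.e. CardyFormulaZ2.

Rationale: WHY THIS LINE. No open route has a mechanism for existence of the limit along the full filter δ → 0⁺
(CardyUniqueLimit files LimitExists, stmt-CriticalPhenomena-0747,
as a bare crux: "no monotonicity / sub-multiplicativity in δ"); this line replaces the global
question by a LOCAL one at the known candidate, using two
structural facts about the set Λ' of subsequential limits: it is connected (the ω-limit set of an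
asymptotically continuous precompact path is
connected — Hale2010 Lemma 3.1.1 — fed by near-miss stability of quad crossings, SchrammSmirnov2011
App. A / GarbanPeteSchramm2013), and its
members inherit every exact lattice structure (translation, DKKMO rotation invariance arXiv201211672
Thm 1.4, reflection/self-duality at p = 1/2,
scale-uniform RSW, Schramm–Smirnov factorisation, locality and domain Markov of explorations). The
bet, imported from deformation/rigidity theory
of SLE (LawlerSchrammWerner2001 locality ⇔ κ = 6; Beffara2008Universal Prop. 4 shears; Werner 2008
doi:10.1090/s0894-0347-07-00557-7 and Cai–Gao
doi:10.1214/25-aop1809 rigidity WITH conformal covariance), is that CLE₆ admits no nearby impostor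
inside that class, so isolation + connectedness
force Λ' = {CLE₆}. Planning sharpened the card: the near-critical scaling limits of
GarbanPeteSchramm2018 (Cor. 86: translation- and rotation-
invariant, Markov, local, NOT scale-invariant, converging to the critical limit as λ → 0) and
boundary-hugging chordal families show that
Euclidean covariance + Markov + locality alone do NOT isolate CLE₆; reflection covariance
(self-duality, λ ↦ −λ) and scale-UNIFORM RSW are
load-bearing, and the continuum crux is filed with exactly that class. Areas imported: topological
dynamics (cluster sets), deformation rigidity of
SLE/CLE; no observable, no interpolation between lattices.

RANKED CRUXES. #2 CardyShadowIsolated (crux) — local uniqueness at the Cardy point (card T3, shadow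
form): if the Cardy shadow g (g R = F(crossRatio x) for every uniformizing datum (φ, x) of R) is a
cluster point, as δ → 0⁺, of the path δ ↦ (R ↦ bondDomainCrossingProb R δ) in the product space
ConformalRectangle → ℝ, then it is an ISOLATED point of the cluster set: some neighbourhood of g
contains no other cluster point. [difficulty: open-problem] (why it might fail: A continuum of
non-Cardy limits may accumulate at g_F: an exactly marginal isometry- and duality-even local scalar
at c=0 (the polychromatic 5-arm operator has dimension exactly 2) would give 1/log(1/δ) drifts; RSW
equicontinuity gives no rate to linearise.) [arXiv:1101.5820, GarbanPeteSchramm2018, Nolin2008,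
doi:10.1090/s0894-0347-07-00557-7, doi:10.1214/25-aop1809, LawlerSchrammWerner2001]
#3 SubseqCardy (crux) — Cardy along ONE sequence of meshes, for all conformal rectangles at once
(card T4, imported): there are δ_n → 0⁺ such that for every conformal rectangle R and every
uniformizing datum (φ, x), bondDomainCrossingProb R δ_n → F(crossRatio x). This makes the Cardy
shadow a cluster point of the crossing-function path; it is the output expected from card
scale-ergodic-quenched-upgrade or from the symmetry-upgrade routes (CardyRotToConf, CardyViaSLE6)
run along a subsequence (Aizenman–Burchard tightness + DKKMO rotations + identification).
[difficulty: open-problem] (why it might fail: Identifying even ONE subsequential limit with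
CLE6/Cardy for all rectangles needs conformal invariance along that subsequence: rotations are known
(DKKMO Thm 1.4) but scale covariance of a subsequential limit is open, and no Z2 observable exists
(Smirnov's is T-only).) [SchrammSmirnov2011, CamiaNewman2007, arXiv201211672, Smirnov2001,
KemppainenSmirnov2017]
#4 ClusterSetConnected (crux) — the cluster set Λ' = {g | g is a cluster point, as δ → 0⁺, of δ ↦ (R
↦ bondDomainCrossingProb R δ)} is (pre)connected in the product space ConformalRectangle → ℝ (card
T1). Intended proof: per-rectangle asymptotic continuity in log δ (support item ScaleContinuity) +
the product-uniformity form of "the ω-limit set of an asymptotically continuous precompact path is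
connected" (Hale2010 Lemma 3.1.1). [difficulty: L] (why it might fail: Needs, for EVERY Jordan
rectangle incl. wild boundaries at the marks, that p_R(δ) varies by o(1) when δ moves by a factor
1+o(1) (near-miss / half-plane 3-arm bounds, SS11 Lemma A.1 type), under G02's largest-component
discretisation; that uniformity is unproved there.) [arXiv:1101.5820, GarbanPeteSchramm2013,
Hale2010, GrimmettPercolation1999]
#9 ScaleContinuity (support) — asymptotic continuity of each crossing probability in the logarithmic
scale: for every conformal rectangle R and ε > 0 there are θ > 0 and δ₀ > 0 with
|bondDomainCrossingProb R δ' − bondDomainCrossingProb R δ| < ε whenever 0 < δ ≤ δ' < δ₀ and δ' ≤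
(1+θ)δ (rescale: p_R(δ/λ) = p_{λR}(δ), then compare the Hausdorff-close rectangles R and λR at one
mesh by RSW + boundary arm estimates). The analytic input of ClusterSetConnected. [difficulty: L]
[arXiv:1101.5820, GarbanPeteSchramm2013, Nolin2008, GrimmettPercolation1999]

TWO-LAYER PLAN. CardyShadowIsolated ⇐ EuclideanLocalRigiditySLE6 → IdentificationGlue →
CardyShadowIsolated, where EuclideanLocalRigiditySLE6 is the continuum
local-rigidity conjecture filed informally after open (SLE₆ isolated among isometry-covariant (incl.
reflections), domain-Markov, local,
target-independent chordal families with a scale-uniform Kemppainen–Smirnov annulus condition;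
infinitesimal form H¹ = 0) and IdentificationGlue
lifts cluster functions near g_F to interface/loop laws near SLE₆/CLE₆ inside that class
(Aizenman–Burchard tightness, DKKMO, Camia–Newman
identification run with the limit kernel). ClusterSetConnected ⇐ ScaleContinuity → UniformityLemma →
ClusterSetConnected (UniformityLemma: pure
topology in the product uniformity, provable now). SubseqCardy is not split here: it is the meeting
point with card scale-ergodic-quenched-upgrade
and with CardyRotToConf / CardyViaSLE6 run along a subsequence.

KILL CRITERIA. Given SubseqCardy and ClusterSetConnected, ¬CardyShadowIsolated is equivalent to
¬CardyFormulaZ2, so a refutation of the rank-2 crux with the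
other two in hand closes every route of the conjunct. The route itself dies (close --reason
refuted:EuclideanLocalRigiditySLE6) if a refuter exhibits
a one-parameter family of chordal (or loop) laws through SLE₆/CLE₆ inside the stated class —
isometry-covariant incl. reflections, Markov, local,
scale-uniformly RSW — other than SLE₆ itself: the four known directions (κ: killed by locality;
shears: by rotations; near-critical/massive SLE₆:
by reflections and uniform RSW; boundary-hugging: by the annulus condition) do not count.
¬ScaleContinuity or ¬ClusterSetConnected by a
wild-boundary witness is a discretisation artefact of G02's discreteCrossing and refutes the
conjunct AS TYPED (report to operator, as for
CardyUniqueLimit.NegDegenerateArcs). LimitExists (stmt-CriticalPhenomena-0747) plus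
CardyUniqueLimitThesis proved elsewhere moot ranks 2 and 4;
SLE6LimitZ2 proved moots the route.

NOT DECOMPOSED YET. The measure-level objects of the card (laws on the Schramm–Smirnov quad-crossing
space, their dilation action, factorisation, passage of
lattice locality/Markov to subsequential limits) — definition request D3 and the IdentificationGlue
above; the linearisation step of the card
(T3: differentiable structure / non-degenerate normalised blow-up near CLE₆, or a Łojasiewicz-type
quantitative replacement); dilation
invariance of Λ' (true, unused by the assembly); the UniformityLemma; any use of the negative side
(log-periodic impostors are card
logperiodic-limitexists-hunt's business).

CHEAPEST FALSIFIER. Run first: is there a DUALITY-EVEN Euclidean, Markov, local deformation of SLE₆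
besides the odd near-critical one? GarbanPeteSchramm2018 §13
(materialised p. 49) finds two exponent pairs (3/4, 1) and (7/4, 0) for a massive-SLE₆ driving SDE
and asks "Does the second pair give a different
massive version of SLE₆?" — if the second solution is a colour-symmetric local Markov family with
scale-uniform arm bounds, H¹_even ≠ 0 and rank 2
rests on nothing. Done this session: GPS Cor. 86 (p. 39) already kills the card's original T2
(translation+rotation+Markov+local) — the class was
corrected before filing. Second cheapest: fit the exact small-system data of card
logperiodic-limitexists-hunt for p_R(δ) − F(η) against a·δ^ω versus
a/log(1/δ); a logarithmic law winning signals a marginal direction and kills rank 2 in practice.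

NUMBERS. Polychromatic 5-arm (plane) exponent = 2 exactly, half-plane 3-arm exponent = 2, half-plane
2-arm = 1 (SmirnovWerner2001; Nolin2008 §§3–4; KSZ
universally for the 5-arm); near-critical scaling λ ↦ α^{-3/4} λ under z ↦ αz, i.e. the thermal
direction has dimension 2 − 5/4 = 3/4 > 0 (relevant,
duality-odd) — GarbanPeteSchramm2018 Cor. 86; RSW crossing bounds for bond-ℤ² at 1/2 uniform in
scale (GrimmettPercolation1999 §11.7, Literature
rsw_half); LPSA 1994 numerics match Cardy on ℤ² to ~5·10⁻³ (arXiv:math/9401222 §3.2). Items at open: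
5 (3 cruxes, 1 support, 1 assembly);
filed right after open: 1 informal crux (rank 5) and 3 definition requests.

DEFINITION REQUESTS. D1 `ChordalFamily.IsIsometryCovariant` (topic
Literature/Probability/RandomPlanarGeometry): covariance of a chordal family under ALL isometries of
ℂ,
including orientation-reversing ones (MarkedDomain.map with a reflection; encodes colour symmetry /
self-duality at p = 1/2), WITHOUT scale covariance.
D2 `ChordalFamily.SatisfiesKSCondition` (same topic): Kemppainen–Smirnov 2017 Condition G2 (unforced
crossings of annuli have probability ≤ 1/2 once
the modulus exceeds one constant), with ONE constant at all scales and all domains. D3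
`QuadCrossingSpace` (topic Literature/Probability/Percolation):
the Schramm–Smirnov compact space ℋ_D of quad-crossing configurations with its dilation action and
the law of bond-ℤ² percolation at mesh δ on it
(SchrammSmirnov2011 §1.3), for the measure-level form of ranks 2–4 and for card
scale-ergodic-quenched-upgrade. All three serve the informal crux
EuclideanLocalRigiditySLE6 (rank 5).

Novelty: Searches (2026-08-15): `lit search --hybrid "omega-limit set connected asymptotically continuous
trajectory isolated equilibrium convergence"` (10 books;
Hale2010 Lemma 3.1.1 read, PDF p. 44); `lit search --source crossref "finite-size corrections
crossing probability percolation square lattice"` (11 rows,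
none on uniqueness of limits); `lit frontier CriticalPhenomena --since 2020` (30 rows: none on
uniqueness / local rigidity of ℤ² subsequential limits);
`lit bridges CriticalPhenomena --cross any` (30 rows, none relevant); `lit read arXiv:1305.5526
--grep rotation|Markov` (GPS2018 Cor. 86, §11, §13 read);
`lean search` MapClusterPt idiom (Literature CLE6SubseqLimit.lean) and the ChordalFamily axioms
(ChordalCurveFamily.lean); `ledger idea list` (all
CardyFormulaZ2 cards: only scale-ergodic-quenched-upgrade and logperiodic-limitexists-hunt touch
LimitExists); openalex / s2 / arxiv remote legs
rate-limited (HTTP 429) this session — recorded, crossref + local index used instead.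
Nearest prior art found: SchrammSmirnov2011 (arXiv:1101.5820: compact quad-crossing space,
subsequential limits of ℤ² percolation exist and factorise —
the ambient set Λ); Werner 2008 doi:10.1090/s0894-0347-07-00557-7 and Cai–Gao 2026
doi:10.1214/25-aop1809 (uniqueness/rigidity at c = 0 WITH conformal
covariance); Schramm2000 + LawlerSchrammWerner2001 (global classification: conformal + Markov ⇒
SLE_κ, locality ⇒ κ = 6) as used by CardyRotToConf r2;
GarbanPeteSchramm2018 Cor. 86 (the near-critical famil  [refs: 10.1090/s0894-0347-07-00557-7, 10.1214/25-aop1809, 1305.5526, 1101.5820, doi:10.1090/s0894-0347-07-00557-7, doi:10.1214/25-aop1809, Hale2010, SchrammSmirnov2011, Schramm2000, LawlerSchrammWerner2001, GarbanPeteSchramm2018]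

Barriers (technique_class: deformation-rigidity, cluster-set-topology, local-upgrade): - technique_class: deformation-rigidity, cluster-set-topology, local-upgrade
- Literature.Barriers.CriticalPhenomena.EmbeddingModulusUniqueness: USED, not evaded — every item is
stated for the ℤ² embedding (bondDomainCrossingProb) and the rigidity class carries rotation AND
reflection covariance, which a sheared copy φ_β(ℤ²) lacks; the shear directions of
Beffara2008Universal Prop. 4 are exactly the deformations excluded by DKKMO rotation invariance (the
barrier's evasion (i)); an embedding-blind version of rank 2 would be false.
- Literature.Barriers.CriticalPhenomena.ScaleCovarianceNotMoebius: catalogued for Ising3D but its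
planar lesson applies and was met head-on: Euclidean + Markov + local data do NOT single out the
conformal point (GarbanPeteSchramm2018 near-critical limits are the percolation witness); the line
adds the model-specific inputs self-duality/reflection covariance and scale-uniform RSW, and bets
that with them CLE₆ is locally rigid.
- Literature.Barriers.CriticalPhenomena.SmirnovTriangularOnly: not in class — no colour switching,
no discrete-holomorphic observable is used.
- Literature.Barriers.CriticalPhenomena.FKParafermionicHalfCauchyRiemann: not in class — no
parafermionic observable.
- Literature.Barriers.CriticalPhenomena.CoveringLatticeShift: not in class — no interpolation
between lattices or covering-lattice maps.
- Negatives index: one refuted statement for the summit (stmt-CriticalPhenomena-0772, SAW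
parafermion tightness) — unrelated to percolat

Novelty grade: new-combination — ROUTE REVIEW (refuter, 2026-08-15): KEEP OPEN, two re-typing recommendations; thin typed layer. All 5 decls elaborate rc0; bondDomainCrossingProb ∈ [0,1], uniformizing data exist, cross-ratios datum-independent ⇒ Cardy shadows well-defined, nothing vacuous; Assembly topology verified. (1) ClusterSet (refuter refuter-rreview-route-ValiantsHypothesis-4aa92cbb-0, 2026-08-15T14:08:43Z; prior: Hale2010 Lemma 3.1.1 (omega-limit set connected), SchrammSmirnov2011 arXiv:1101.5820, LawlerSchrammWerner2001 / Werner2008 doi:10.1090/s0894-0347-07-00557-7 / CaiGao doi:10.1214/25-aop1809, GarbanPeteSchramm2018 Cor 86, DKKMO arXiv:2012.11672 Thm 1.4)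

History (route lifecycle, newest last):
- 2026-08-25T14:51:34Z · DORMANT — reconciler: no traction for 7.8 d (last activity item-evidence-added at 2026-08-17T19:17:51Z); parked, not closed — `ledger route dormant route-CriticalPhenomen (operator:999:2765294)

sub-problem: CardyFormulaZ2 · status: dormant · opened planner-plancard-CriticalPhenomena-CardyFormu-4f5a080a-0 2026-08-15T11:42:24Z · rev 2 · ledger route-CriticalPhenomena-CardyLocalRigidity
GENERATED by the gate from the ledger (D-0016/17). Provers cite these decls: `theorem foo : Summit.CriticalPhenomena.CardyFormulaZ2.Theses.CardyLocalRigidity.<Decl> := …` in Summits/CriticalPhenomena/CardyFormulaZ2/Theorems/<Name>.lean.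
-/

namespace Summit.CriticalPhenomena.CardyFormulaZ2.Theses.CardyLocalRigidity

open scoped BigOperators Topology Manifold Classical MeasureTheory ProbabilityTheory Matrix InnerProductSpace ComplexConjugate ContinuousMap
open Filter Set Function TopologicalSpace MeasureTheory

attribute [summit_statement] _root_.CardyFormulaZ2

/-- item stmt-CriticalPhenomena-5767 · crux · rank 2 · open · by planner
why it might fail: Isolation is in the PRODUCT topology (finite determination) and, given SubseqCardy + ClusterSetConnected, equivalent to CardyFormulaZ2: fails iff non-Cardy cluster points accumulate at g_F, e.g. via an exactly marginal duality-even direction at c=0 (5-arm dimension 2; GPS18 §13), 1/log(1/δ) drifts.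
sources: GarbanPeteSchramm2018, LawlerSchrammWerner2001, Werner2008SelfAvoidingLoops, doi:10.1214/25-aop1809, SmirnovWerner2001, Nolin2008
[crux] local uniqueness at the Cardy point (card T3, shadow form): if the Cardy shadow g (g R =
F(crossRatio x) for every uniformizing datum (φ, x) of R) is a cluster point, as δ → 0⁺, of the path
δ ↦ (R ↦ bondDomainCrossingProb R δ) in the product space ConformalRectangle → ℝ, then it is an
ISOLATED point of the cluster set: some neighbourhood of g contains no other cluster point.
[difficulty: open-problem] -/
@[route_item "route-CriticalPhenomena-CardyLocalRigidity", crux]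
def CardyShadowIsolated : Prop :=
  ∀ g : Literature.Probability.RandomPlanarGeometry.ConformalRectangle → ℝ, (∀ (R : Literature.Probability.RandomPlanarGeometry.ConformalRectangle) (φ : Literature.Probability.RandomPlanarGeometry.ConformalEquiv UpperHalfPlane.upperHalfPlaneSet R.carrier) (x : Fin 4 → ℝ), R.IsUniformizing φ x → g R = Literature.Probability.RandomPlanarGeometry.cardyFunction (Literature.Probability.RandomPlanarGeometry.crossRatio x)) → MapClusterPt g (nhdsWithin (0 : ℝ) (Set.Ioi 0)) (fun (δ : ℝ) (R : Literature.Probability.RandomPlanarGeometry.ConformalRectangle) => Literature.Probability.Percolation.bondDomainCrossingProb R δ) → ∃ U ∈ nhds g, ∀ g' ∈ U, MapClusterPt g' (nhdsWithin (0 : ℝ) (Set.Ioi 0)) (fun (δ : ℝ) (R : Literature.Probability.RandomPlanarGeometry.ConformalRectangle) => Literature.Probability.Percolation.bondDomainCrossingProb R δ) → g' = g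

/-- item stmt-CriticalPhenomena-5768 · crux · rank 3 · open · by planner
why it might fail: Cardy's value along even one mesh sequence needs conformal (dilation+rotation) covariance of a Z2 subsequential limit: rotations are known (DKKMO Thm 1.4), dilations are open, and no Z2 holomorphic observable exists (Smirnov's is T-only); as typed ONE sequence must serve uncountably many R.
sources: Smirnov2001, DKKMO2020Rotational, SchrammSmirnov2011, CamiaNewman2007, KemppainenSmirnov2017, Beffara2008Universal
[crux] Cardy along ONE sequence of meshes, for all conformal rectangles at once (card T4, imported):
there are δ_n → 0⁺ such that for every conformal rectangle R and every uniformizing datum (φ, x),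
bondDomainCrossingProb R δ_n → F(crossRatio x). This makes the Cardy shadow a cluster point of the
crossing-function path; it is the output expected from card scale-ergodic-quenched-upgrade or from
the symmetry-upgrade routes (CardyRotToConf, CardyViaSLE6) run along a subsequence
(Aizenman–Burchard tightness + DKKMO rotations + identification). [difficulty: open-problem] -/
@[route_item "route-CriticalPhenomena-CardyLocalRigidity", crux]
def SubseqCardy : Prop :=
  ∃ u : ℕ → ℝ, Filter.Tendsto u Filter.atTop (nhdsWithin (0 : ℝ) (Set.Ioi 0)) ∧ ∀ (R : Literature.Probability.RandomPlanarGeometry.ConformalRectangle) (φ : Literature.Probability.RandomPlanarGeometry.ConformalEquiv UpperHalfPlane.upperHalfPlaneSet R.carrier) (x : Fin 4 → ℝ), R.IsUniformizing φ x → Filter.Tendsto (fun n => Literature.Probability.Percolation.bondDomainCrossingProb R (u n)) Filter.atTop (nhds (Literature.Probability.RandomPlanarGeometry.cardyFunction (Literature.Probability.RandomPlanarGeometry.crossRatio x)))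

/-- item stmt-CriticalPhenomena-5769 · crux · rank 4 · closed · proved by Summit.CriticalPhenomena.CardyFormulaZ2.Theorems.ClusterSetConnected.clusterSetConnected @ 241f0b218bed (prover) · by planner
why it might fail: False as typed iff some p_R(δ) has a non-interval cluster set. Printed near-miss continuity (SS11 Lemma 6.1) covers nested perturbations (1)-(3) only, GPS13 quads are piecewise smooth; R vs λR for non-star-shaped wild Jordan R under G02's largest-component/infDist-arc discretisation is unwritten.
sources: arXiv:1101.5820, GarbanPeteSchramm2013Pivotal, Hale2010, GrimmettPercolation1999
[crux] the cluster set Λ' = {g | g is a cluster point, as δ → 0⁺, of δ ↦ (R ↦ bondDomainCrossingProb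
R δ)} is (pre)connected in the product space ConformalRectangle → ℝ (card T1). Intended proof:
per-rectangle asymptotic continuity in log δ (support item ScaleContinuity) + the product-uniformity
form of "the ω-limit set of an asymptotically continuous precompact path is connected" (Hale2010
Lemma 3.1.1). [difficulty: L] -/
@[route_item "route-CriticalPhenomena-CardyLocalRigidity", crux]
def ClusterSetConnected : Prop :=
  IsPreconnected {g : Literature.Probability.RandomPlanarGeometry.ConformalRectangle → ℝ | MapClusterPt g (nhdsWithin (0 : ℝ) (Set.Ioi 0)) (fun (δ : ℝ) (R : Literature.Probability.RandomPlanarGeometry.ConformalRectangle) => Literature.Probability.Percolation.bondDomainCrossingProb R δ)}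

-- `ClusterSetConnected` holds: proved by `Summit.CriticalPhenomena.CardyFormulaZ2.Theorems.ClusterSetConnected.clusterSetConnected` @ 241f0b218bed (its module imports this route file, so no `_holds` link can be stated here).

-- item stmt-CriticalPhenomena-6806 · crux · rank 5 · open · by planner — informal only, no Lean statement yet:
--   [crux] EuclideanLocalRigiditySLE6 (continuum interior of CardyShadowIsolated; card T2/T3 CORRECTED
--   while planning). Chordal SLE6 is an ISOLATED point, for pointwise-in-D weak convergence of the laws
--   P D on CurveClass C, of the class C_ch of chordal curve families P : DobrushinDomain -> Measure
--   (CurveClass C) that are (i) covariant under ALL isometries of C including orientation-reversing ones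
--   (reflection covariance = colour symmetry / self-duality at p = 1/2; definition request D1
--   IsIsometryCovariant) but NOT assumed scale covariant, (ii) domain Markov
--   (ChordalFamily.IsDomainMarkov), (iii) loc

/-- item stmt-CriticalPhenomena-5770 · support · rank 9 · closed · proved by Summit.CriticalPhenomena.CardyFormulaZ2.Theorems.ClusterSetConnected.scaleContinuity (prover) · by planner
sources: arXiv:1101.5820, GarbanPeteSchramm2013, Nolin2008, GrimmettPercolation1999
[support] asymptotic continuity of each crossing probability in the logarithmic scale: for every
conformal rectangle R and ε > 0 there are θ > 0 and δ₀ > 0 with |bondDomainCrossingProb R δ' −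
bondDomainCrossingProb R δ| < ε whenever 0 < δ ≤ δ' < δ₀ and δ' ≤ (1+θ)δ (rescale: p_R(δ/λ) =
p_{λR}(δ), then compare the Hausdorff-close rectangles R and λR at one mesh by RSW + boundary arm
estimates). The analytic input of ClusterSetConnected. [difficulty: L] -/
@[route_item "route-CriticalPhenomena-CardyLocalRigidity"]
def ScaleContinuity : Prop :=
  ∀ (R : Literature.Probability.RandomPlanarGeometry.ConformalRectangle) (ε : ℝ), 0 < ε → ∃ θ > (0 : ℝ), ∃ δ₀ > (0 : ℝ), ∀ δ δ' : ℝ, 0 < δ → δ ≤ δ' → δ' < δ₀ → δ' ≤ (1 + θ) * δ → |Literature.Probability.Percolation.bondDomainCrossingProb R δ' - Literature.Probability.Percolation.bondDomainCrossingProb R δ| < ε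

-- `ScaleContinuity` holds: proved by `Summit.CriticalPhenomena.CardyFormulaZ2.Theorems.ClusterSetConnected.scaleContinuity` (its module imports this route file, so no `_holds` link can be stated here).

/-- item stmt-CriticalPhenomena-5771 · assembly · rank 1 · closed · proved by Summit.CriticalPhenomena.CardyFormulaZ2.Theorems.cardyAnchoredRigidity_assembly_proof (prover) · by planner
sources: Hale2010, arXiv:1101.5820
[assembly] SubseqCardy → ClusterSetConnected → CardyShadowIsolated → CardyFormulaZ2 (the
connectedness lever plus compactness of [0,1]^{ConformalRectangle}). -/
@[route_item "route-CriticalPhenomena-CardyLocalRigidity"]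
def Assembly : Prop :=
  SubseqCardy → ClusterSetConnected → CardyShadowIsolated → CardyFormulaZ2

/-- `Assembly` holds: proved by `Summit.CriticalPhenomena.CardyFormulaZ2.Theorems.cardyAnchoredRigidity_assembly_proof`. -/
theorem Assembly_holds : Assembly := _root_.Summit.CriticalPhenomena.CardyFormulaZ2.Theorems.cardyAnchoredRigidity_assembly_proof

/-! D-0027 §2.1 — DECIDING THEOREM (planner-authored via `route open/edit --closes-file`; by planner-rbadge-CriticalPhenomena-CardyLocalRig-5dc4bc1d-g4-0 2026-08-15T16:14:53Z):
its hypotheses are this route's items and its conclusion the sub-problem Statement (glue_lint), and it elaborates with this file. -/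

@[closes "route-CriticalPhenomena-CardyLocalRigidity"] theorem closes (hSub : SubseqCardy) (hConn : ClusterSetConnected) (hIso : CardyShadowIsolated) :
    _root_.CardyFormulaZ2 := by
  -- D-0027 §2.1 deciding theorem of route CardyLocalRigidity. Hypotheses: the three cruxes only
  -- (SubseqCardy, ClusterSetConnected, CardyShadowIsolated); conclusion: the sub-problem Statement
  -- by name. The point-set topology of the former `Assembly` item is proved HERE, sorry-free and
  -- without any named Literature fact (in particular neither `exists_isUniformizing` nor
  -- `crossRatio_eq_of_isUniformizing` is used: the shadow identity is only needed at rectangles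
  -- that carry a uniformizing datum, and SubseqCardy makes it datum-independent there).
  -- (0) every crossing function lives in the compact box [0,1]^ConformalRectangle (Tychonoff)
  have hK : IsCompact (Set.pi Set.univ
      (fun _ : Literature.Probability.RandomPlanarGeometry.ConformalRectangle => Set.Icc (0 : ℝ) 1)) :=
    isCompact_univ_pi fun _ => isCompact_Icc
  have hPK : ∀ δ : ℝ,
      (fun R : Literature.Probability.RandomPlanarGeometry.ConformalRectangle =>
          Literature.Probability.Percolation.bondDomainCrossingProb R δ) ∈
        Set.pi Set.univ
          (fun _ : Literature.Probability.RandomPlanarGeometry.ConformalRectangle =>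
            Set.Icc (0 : ℝ) 1) :=
    fun δ => Set.mem_univ_pi.2 fun R =>
      Literature.Probability.Percolation.bondDomainCrossingProb_mem_Icc R δ
  -- (1) SubseqCardy: a sequence of meshes u n → 0⁺ along which Cardy holds for every datum;
  --     the sequence of crossing functions has a cluster point g in the compact box
  obtain ⟨u, hu, hlim⟩ := hSub
  obtain ⟨g, -, hg⟩ := hK.exists_mapClusterPt_of_frequently (l := Filter.atTop)
    (f := fun (n : ℕ) (R : Literature.Probability.RandomPlanarGeometry.ConformalRectangle) =>
      Literature.Probability.Percolation.bondDomainCrossingProb R (u n))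
    (Filter.Eventually.of_forall fun n => hPK (u n)).frequently
  -- g is a cluster point of the crossing-function path along 𝓝[>] 0 (map u atTop ≤ 𝓝[>] 0)
  have hgL : MapClusterPt g (nhdsWithin (0 : ℝ) (Set.Ioi 0))
      (fun (δ : ℝ) (R : Literature.Probability.RandomPlanarGeometry.ConformalRectangle) =>
        Literature.Probability.Percolation.bondDomainCrossingProb R δ) :=
    MapClusterPt.of_comp hu hg
  -- g is a Cardy shadow: each coordinate with a uniformizing datum converges along u (SubseqCardy),
  -- the coordinate of a cluster point is a cluster point of the coordinate sequence (continuity of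
  -- evaluation), and a cluster value of a convergent real sequence is its limit (ℝ is T₂)
  have hshadow : ∀ (R : Literature.Probability.RandomPlanarGeometry.ConformalRectangle)
      (φ : Literature.Probability.RandomPlanarGeometry.ConformalEquiv
        UpperHalfPlane.upperHalfPlaneSet R.carrier)
      (x : Fin 4 → ℝ), R.IsUniformizing φ x →
        g R = Literature.Probability.RandomPlanarGeometry.cardyFunction
          (Literature.Probability.RandomPlanarGeometry.crossRatio x) := by
    intro R φ x hux
    have h1 : MapClusterPt (g R) Filter.atTop
        (fun n : ℕ => Literature.Probability.Percolation.bondDomainCrossingProb R (u n)) :=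
      hg.continuousAt_comp (continuous_apply R).continuousAt
    have h2 : Filter.map
        (fun n : ℕ => Literature.Probability.Percolation.bondDomainCrossingProb R (u n))
          Filter.atTop ≤
        nhds (Literature.Probability.RandomPlanarGeometry.cardyFunction
          (Literature.Probability.RandomPlanarGeometry.crossRatio x)) :=
      hlim R φ x hux
    exact eq_of_nhds_neBot (h1.clusterPt.mono h2).neBot
  -- (2) CardyShadowIsolated: a neighbourhood U of g meets the cluster set only in g;
  --     ClusterSetConnected with the open sets `interior U`, `{g}ᶜ` forces the cluster set into {g}
  obtain ⟨U, hU, hUiso⟩ := hIso g hshadow hgL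
  have hΛ : IsPreconnected
      {g' : Literature.Probability.RandomPlanarGeometry.ConformalRectangle → ℝ |
        MapClusterPt g' (nhdsWithin (0 : ℝ) (Set.Ioi 0))
          (fun (δ : ℝ) (R : Literature.Probability.RandomPlanarGeometry.ConformalRectangle) =>
            Literature.Probability.Percolation.bondDomainCrossingProb R δ)} :=
    hConn
  have hgint : g ∈ interior U := mem_interior_iff_mem_nhds.2 hU
  have hcover : ∀ h : Literature.Probability.RandomPlanarGeometry.ConformalRectangle → ℝ,
      h ∈ interior U ∪
        ({g} : Set (Literature.Probability.RandomPlanarGeometry.ConformalRectangle → ℝ))ᶜ := by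
    intro h
    by_cases e : h = g
    · rw [e]
      exact Set.mem_union_left _ hgint
    · exact Set.mem_union_right _ (Set.mem_compl_singleton_iff.2 e)
  have huniq : ∀ g' : Literature.Probability.RandomPlanarGeometry.ConformalRectangle → ℝ,
      MapClusterPt g' (nhdsWithin (0 : ℝ) (Set.Ioi 0))
        (fun (δ : ℝ) (R : Literature.Probability.RandomPlanarGeometry.ConformalRectangle) =>
          Literature.Probability.Percolation.bondDomainCrossingProb R δ) → g' = g := by
    intro g' hg'
    by_contra hne
    obtain ⟨h, hhΛ, hhU, hhg⟩ := hΛ (interior U)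
      ({g} : Set (Literature.Probability.RandomPlanarGeometry.ConformalRectangle → ℝ))ᶜ
      isOpen_interior isOpen_compl_singleton (fun h _ => hcover h)
      ⟨g, hgL, hgint⟩ ⟨g', hg', Set.mem_compl_singleton_iff.2 hne⟩
    exact (Set.mem_compl_singleton_iff.1 hhg) (hUiso h (interior_subset hhU) hhΛ)
  -- (3) a path with values in a compact set and a unique cluster point there converges
  have htend : Filter.Tendsto
      (fun (δ : ℝ) (R : Literature.Probability.RandomPlanarGeometry.ConformalRectangle) =>
        Literature.Probability.Percolation.bondDomainCrossingProb R δ)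
      (nhdsWithin (0 : ℝ) (Set.Ioi 0)) (nhds g) :=
    hK.tendsto_nhds_of_unique_mapClusterPt (Filter.Eventually.of_forall hPK)
      fun g' _ hg' => huniq g' hg'
  -- (4) coordinate projection + the shadow identity = `R.HasCrossingLimit`, i.e. CardyFormulaZ2
  intro R φ x hux
  have hR := tendsto_pi_nhds.1 htend R
  rw [hshadow R φ x hux] at hR
  exact hR

end Summit.CriticalPhenomena.CardyFormulaZ2.Theses.CardyLocalRigidity
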